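import Literature.NumberTheory.Transcendental.LocusComponents
import Literature.RingTheory.KrullDimension.FibreInequality
import HarnessLib

/-!
# Bays–Kirby 2018, Prop. 11.5 without Thm 11.4 — step 3: specialising a fibre dimension

Support file for the direct proof of `Literature.NumberTheory.Transcendental.BaysKirby2018_prop_11_5`
(Bays–Kirby 2018, Prop. 11.5). In the compactness argument the nonstandard point `(p*, ζ*)` of the
ultrapower has `K₀`-locus `Z = Z(𝔯)`, `𝔯 ⊆ K₀[P, X]` prime, projecting to the `K₀`-locus
`Y = Z(𝔮)` of the parameters `p*`, `𝔮 = 𝔯 ∩ K₀[P]`; Ax's theorem bounds the *generic* fibre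
dimension `dim Z - dim Y` from below, and the conclusion needed at the standard levels is a lower
bound for the dimension of the fibre of `Z_F` over the *special* `F`-points `p_k`. This is the
fibre-dimension inequality (Shafarevich I.6.3 Thm 1.25 / Springer 5.1.6: every component of a
non-empty fibre of a dominant morphism `Z → Y` of irreducible varieties has dimension
`≥ dim Z - dim Y`), in the tree as
`Literature.RingTheory.KrullDimension.ringKrullDim_le_ringKrullDim_quotient_add`, here dressed
for the two-field situation (coefficients in `k`, points in the algebraically closed `F`):

* `exists_fibre_component` — for a prime `𝔯 ⊆ k[σ ⊕ ι]` with `dim k[σ ⊕ ι]⧸𝔯 ≥ dim k[σ]⧸𝔮 + e`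
  (`𝔮` the contraction) and an `F`-point `(p, z)` of `Z_F(𝔯)`, there is an irreducible Zariski
  closed `X ∋ z` in `F^ι`, of dimension `≥ e`, all of whose points `w` satisfy `(p, w) ∈ Z_F(𝔯)`.
  (Base change to `F`: a minimal prime `Q` of `𝔯F[σ ⊕ ι]` through the point has `dim = dim 𝔯`
  (`LocusComponents.ringKrullDim_quotient_eq_of_mem_minimalPrimes_map`) and contracts into a
  quotient of a component of `𝔮 F[σ]`, of dimension `≤ dim 𝔮`; the fibre inequality at the maximal
  ideal of `p` gives a prime `P ⊇ Q + (Pₛ - pₛ)ₛ` through the point with `dim ≥ e`, and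
  substituting `p` identifies `F[σ ⊕ ι]⧸P` with a quotient of `F[ι]`, whose zero set is `X`.)
* `exists_ringKrullDim_quotient_ker_aeval` — `dim k[κ] ⧸ I_k(P) = trdeg_k k[P]` for a point `P`
  with coordinates in any field extension of `k` (dimension = transcendence degree).

## References

* M. Bays, J. Kirby, *Pseudo-exponential maps, variants, and quasiminimality*, ANT 12 (2018),
  Prop. 11.5.
* I. R. Shafarevich, *Basic Algebraic Geometry 1*, I.6.3, Thm 1.25.
* T. A. Springer, *Linear Algebraic Groups*, 2nd ed., 5.1.6.
-/

noncomputable section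

open MvPolynomial Set

universe u

namespace Literature.NumberTheory.Transcendental.Prop115

attribute [local instance] MvPolynomial.algebraMvPolynomial

/-! ### Dimension of the locus of a point = transcendence degree -/

section Trdeg

variable (k : Type u) {E : Type u} [Field k] [Field E] [Algebra k E] {κ : Type} [Fintype κ]

/-- **`dim k[X] ⧸ I_k(P) = trdeg_k k[P]`** for a point `P ∈ E^κ` of a field extension `E ⊇ k`
(the quotient is the affine domain `k[P]`; dimension = transcendence degree, Matsumura Thm 5.6).
[cite: Matsumura1987, Thm 5.6] -/
theorem exists_ringKrullDim_quotient_ker_aeval (P : κ → E) :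
    ∃ d : ℕ, ringKrullDim (MvPolynomial κ k ⧸
        RingHom.ker (aeval P : MvPolynomial κ k →ₐ[k] E).toRingHom) = d ∧
      (d : Cardinal) = Algebra.trdeg k (Algebra.adjoin k (range P)) := by
  classical
  set φ := (aeval P : MvPolynomial κ k →ₐ[k] E) with hφ
  haveI : (RingHom.ker φ.toRingHom).IsPrime := RingHom.ker_isPrime _
  haveI : IsDomain (MvPolynomial κ k ⧸ RingHom.ker φ.toRingHom) := Ideal.Quotient.isDomain _
  have e : (MvPolynomial κ k ⧸ RingHom.ker φ.toRingHom) ≃ₐ[k] φ.range :=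
    (Ideal.quotientEquivAlgOfEq k (AlgHom.ker_rangeRestrict φ).symm).trans
      (Ideal.quotientKerAlgEquivOfSurjective (AlgHom.rangeRestrict_surjective φ))
  have hrange : φ.range = Algebra.adjoin k (range P) := (Algebra.adjoin_range_eq_range_aeval k P).symm
  obtain ⟨d, hd, hdt⟩ := Literature.RingTheory.KrullDimension.exists_ringKrullDim_eq_and_trdeg_eq k
    (MvPolynomial κ k ⧸ RingHom.ker φ.toRingHom)
  refine ⟨d, hd, ?_⟩
  rw [← hdt, AlgEquiv.trdeg_eq e, hrange]

end Trdeg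

/-! ### Partial evaluation of the parameter variables -/

section PartialEval

variable {F : Type u} [Field F] {σ ι : Type}

/-- The substitution `Pₛ ↦ pₛ`, `Xᵢ ↦ Xᵢ` on `F[σ ⊕ ι]` (an `F`-algebra endomorphism). [folklore] -/
def substParams (p : σ → F) : MvPolynomial (σ ⊕ ι) F →ₐ[F] MvPolynomial (σ ⊕ ι) F :=
  aeval (Sum.elim (fun s => C (p s)) (fun i => X (Sum.inr i)))

/-- **`f ≡ f(p, X)` modulo the ideal `(Pₛ - pₛ)ₛ`.** [folklore] -/
theorem sub_substParams_mem (p : σ → F) (I : Ideal (MvPolynomial (σ ⊕ ι) F))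
    (hI : ∀ s, (X (Sum.inl s) - C (p s) : MvPolynomial (σ ⊕ ι) F) ∈ I)
    (f : MvPolynomial (σ ⊕ ι) F) : f - substParams p f ∈ I := by
  induction f using MvPolynomial.induction_on with
  | C a => simp [substParams]
  | add f g hf hg =>
    have : f + g - substParams p (f + g) = (f - substParams p f) + (g - substParams p g) := by
      rw [map_add]; ring
    rw [this]; exact I.add_mem hf hg
  | mul_X f v hf =>
    have : f * X v - substParams p (f * X v) =
        (f - substParams p f) * X v + substParams p f * (X v - substParams p (X v)) := by
      rw [map_mul]; ring
    rw [this]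
    refine I.add_mem (I.mul_mem_right _ hf) (I.mul_mem_left _ ?_)
    rcases v with s | i
    · simpa [substParams] using hI s
    · simp [substParams]

/-- The substitution kills nothing new on the `ι`-variables: `substParams p (rename inr g) = rename
inr g`. [folklore] -/
theorem substParams_rename_inr (p : σ → F) (g : MvPolynomial ι F) :
    substParams p (rename (Sum.inr : ι → σ ⊕ ι) g) = rename Sum.inr g := by
  rw [substParams, aeval_rename]
  induction g using MvPolynomial.induction_on with
  | C a => simp
  | add f g hf hg => simp only [map_add, hf, hg]
  | mul_X f i hf => simp only [map_mul, hf, aeval_X, Function.comp_apply, Sum.elim_inr, rename_X]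

/-- `substParams p f` lies in the image of `rename inr` (it involves only the `ι`-variables).
[folklore] -/
theorem exists_rename_eq_substParams (p : σ → F) (f : MvPolynomial (σ ⊕ ι) F) :
    ∃ g : MvPolynomial ι F, rename Sum.inr g = substParams p f := by
  induction f using MvPolynomial.induction_on with
  | C a => exact ⟨C a, by simp [substParams]⟩
  | add f f' hf hf' =>
    obtain ⟨g, hg⟩ := hf
    obtain ⟨g', hg'⟩ := hf'
    exact ⟨g + g', by rw [map_add, map_add, hg, hg']⟩
  | mul_X f v hf =>
    obtain ⟨g, hg⟩ := hf
    rcases v with s | i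
    · exact ⟨g * C (p s), by rw [map_mul, map_mul, hg, rename_C]; simp [substParams]⟩
    · exact ⟨g * X i, by rw [map_mul, map_mul, hg, rename_X]; simp [substParams]⟩

/-- Evaluating at `(p, w)` factors through the substitution. [folklore] -/
theorem aeval_sumElim_substParams (p : σ → F) (w : ι → F) (f : MvPolynomial (σ ⊕ ι) F) :
    aeval (Sum.elim p w) (substParams p f) = aeval (Sum.elim p w) f := by
  rw [substParams, ← AlgHom.comp_apply, comp_aeval]
  congr 1
  ext v
  rcases v with s | i <;> simp

/-- Evaluating `rename inr g` at `(p, w)` is evaluating `g` at `w`. [folklore] -/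
theorem aeval_sumElim_rename_inr (p : σ → F) (w : ι → F) (g : MvPolynomial ι F) :
    aeval (Sum.elim p w) (rename (Sum.inr : ι → σ ⊕ ι) g) = aeval w g := by
  rw [aeval_rename]; rfl

end PartialEval

/-! ### The fibre-dimension inequality at a special point, two-field form -/

section Fibre

variable {k F : Type u} [Field k] [Field F] [Algebra k F] [IsAlgClosed F] {σ ι : Type}
  [Fintype σ] [Fintype ι]

/-- **Specialising the generic fibre dimension.** Let `𝔯 ⊆ k[σ ⊕ ι]` be prime, `𝔮 = 𝔯 ∩ k[σ]`
its contraction, and suppose `dim k[σ ⊕ ι]⧸𝔯 ≥ dim k[σ]⧸𝔮 + e`. Then for every `F`-point `(p, z)`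
of `Z_F(𝔯)` (`F` algebraically closed) there is an irreducible Zariski closed subset `X ∋ z` of
`F^ι` of dimension `≥ e` with `(p, w) ∈ Z_F(𝔯)` for all `w ∈ X` (the component through `(p, z)`
of the fibre over `p` of the component of `Z_F(𝔯)` through `(p, z)`; fibre-dimension inequality,
Shafarevich I.6.3 Thm 1.25; Springer 5.1.6). [cite: Springer1998, 5.1.6] [cite: Matsumura1987, Thm 15.1] -/
theorem exists_fibre_component (𝔯 : Ideal (MvPolynomial (σ ⊕ ι) k)) [𝔯.IsPrime] {dZ dY e : ℕ}
    (hdZ : ringKrullDim (MvPolynomial (σ ⊕ ι) k ⧸ 𝔯) = dZ)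
    (hdY : ringKrullDim (MvPolynomial σ k ⧸
      𝔯.comap (rename (Sum.inl : σ → σ ⊕ ι) : MvPolynomial σ k →ₐ[k] MvPolynomial (σ ⊕ ι) k)) = dY)
    (he : dY + e ≤ dZ) {p : σ → F} {z : ι → F} (hpz : Sum.elim p z ∈ zeroLocus F 𝔯) :
    ∃ X : Set (ι → F), z ∈ X ∧ IsIrreducibleClosed F X ∧ (∀ w ∈ X, Sum.elim p w ∈ zeroLocus F 𝔯) ∧
      (((e : ℕ) : ℕ∞) : WithBot ℕ∞) ≤ zariskiDim F X := by
  classical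
  -- base change and the component through the point
  set x₀ : σ ⊕ ι → F := Sum.elim p z with hx₀
  set 𝔯' : Ideal (MvPolynomial (σ ⊕ ι) F) :=
    𝔯.map (algebraMap (MvPolynomial (σ ⊕ ι) k) (MvPolynomial (σ ⊕ ι) F)) with h𝔯'
  set evx : MvPolynomial (σ ⊕ ι) F →ₐ[F] F := aeval x₀ with hevx
  set 𝔪 : Ideal (MvPolynomial (σ ⊕ ι) F) := RingHom.ker evx.toRingHom with h𝔪
  have hmem𝔪 : ∀ f, f ∈ 𝔪 ↔ aeval x₀ f = 0 := fun f => by rw [h𝔪, RingHom.mem_ker]; rfl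
  haveI h𝔪max : 𝔪.IsMaximal :=
    RingHom.ker_isMaximal_of_surjective evx.toRingHom fun a => ⟨C a, by simp [hevx]⟩
  have halg : ∀ f : MvPolynomial (σ ⊕ ι) k,
      algebraMap (MvPolynomial (σ ⊕ ι) k) (MvPolynomial (σ ⊕ ι) F) f =
        MvPolynomial.map (algebraMap k F) f := fun f => by rw [MvPolynomial.algebraMap_def]
  have h𝔯'𝔪 : 𝔯' ≤ 𝔪 := by
    rw [h𝔯', Ideal.map_le_iff_le_comap]
    intro f hf
    rw [Ideal.mem_comap, hmem𝔪, halg, aeval_map_algebraMap]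
    exact (mem_zeroLocus_iff.1 hpz) f hf
  obtain ⟨Q, hQ, hQ𝔪⟩ := Ideal.exists_minimalPrimes_le h𝔯'𝔪
  haveI hQp : Q.IsPrime := hQ.1.1
  have hdimQ : ringKrullDim (MvPolynomial (σ ⊕ ι) F ⧸ Q) = dZ := by
    rw [LocusComponents.ringKrullDim_quotient_eq_of_mem_minimalPrimes_map hQ, hdZ]
  -- the parameter side
  set ρ : MvPolynomial σ F →ₐ[F] MvPolynomial (σ ⊕ ι) F := rename Sum.inl with hρ
  set 𝔮 : Ideal (MvPolynomial σ k) :=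
    𝔯.comap (rename (Sum.inl : σ → σ ⊕ ι) : MvPolynomial σ k →ₐ[k] MvPolynomial (σ ⊕ ι) k) with h𝔮
  set Qσ : Ideal (MvPolynomial σ F) := Q.comap ρ with hQσ
  have h𝔮Qσ : 𝔮.map (algebraMap (MvPolynomial σ k) (MvPolynomial σ F)) ≤ Qσ := by
    rw [Ideal.map_le_iff_le_comap]
    intro g hg
    rw [Ideal.mem_comap, hQσ, Ideal.mem_comap]
    have h1 : ρ (algebraMap (MvPolynomial σ k) (MvPolynomial σ F) g) =
        algebraMap (MvPolynomial (σ ⊕ ι) k) (MvPolynomial (σ ⊕ ι) F) (rename Sum.inl g) := by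
      rw [halg, MvPolynomial.algebraMap_def, hρ, map_rename]
    rw [h1]
    exact hQ.1.2 (Ideal.mem_map_of_mem _ (Ideal.mem_comap.1 hg))
  obtain ⟨Q₁, hQ₁, hQ₁le⟩ := Ideal.exists_minimalPrimes_le h𝔮Qσ
  have hdimQσ : ringKrullDim (MvPolynomial σ F ⧸ Qσ) ≤ dY := by
    refine (ringKrullDim_le_of_surjective (Ideal.Quotient.factor hQ₁le)
      (Ideal.Quotient.factor_surjective hQ₁le)).trans_eq ?_
    rw [LocusComponents.ringKrullDim_quotient_eq_of_mem_minimalPrimes_map hQ₁, hdY]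
  -- the rings `A = F[σ ⊕ ι]⧸Q`, `B = F[σ]⧸Qσ` and the map between them
  set A := MvPolynomial (σ ⊕ ι) F ⧸ Q with hA
  set B := MvPolynomial σ F ⧸ Qσ with hB
  haveI : IsDomain A := Ideal.Quotient.isDomain Q
  haveI : IsDomain B := Ideal.Quotient.isDomain Qσ
  let φ : B →ₐ[F] A := Ideal.quotientMapₐ Q ρ le_rfl
  have hφmk : ∀ g, φ (Ideal.Quotient.mk Qσ g) = Ideal.Quotient.mk Q (ρ g) := fun g => rfl
  -- the maximal ideal of `B` at `p`
  have hQσp : ∀ g ∈ Qσ, aeval p g = 0 := by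
    intro g hg
    have h1 : ρ g ∈ 𝔪 := hQ𝔪 (Ideal.mem_comap.1 hg)
    rw [hmem𝔪, hρ, aeval_rename] at h1
    exact h1
  let evp : B →ₐ[F] F := Ideal.Quotient.liftₐ Qσ (aeval p) hQσp
  set m : Ideal B := RingHom.ker evp.toRingHom with hm
  haveI hmmax : m.IsMaximal :=
    RingHom.ker_isMaximal_of_surjective evp.toRingHom fun a =>
      ⟨Ideal.Quotient.mk Qσ (C a), by
        show evp (Ideal.Quotient.mk Qσ (C a)) = a
        rw [Ideal.Quotient.liftₐ_apply, Ideal.Quotient.lift_mk]; simp⟩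
  -- the prime of `A` at `x₀` and a minimal prime of `m A` below it
  have hQx : ∀ f ∈ Q, aeval x₀ f = 0 := fun f hf => (hmem𝔪 f).1 (hQ𝔪 hf)
  let evA : A →ₐ[F] F := Ideal.Quotient.liftₐ Q (aeval x₀) hQx
  set 𝔪A : Ideal A := RingHom.ker evA.toRingHom with h𝔪A
  haveI : 𝔪A.IsPrime := RingHom.ker_isPrime _
  have hmφ : m.map φ ≤ 𝔪A := by
    rw [Ideal.map_le_iff_le_comap]
    intro b hb
    obtain ⟨g, rfl⟩ := Ideal.Quotient.mk_surjective b
    rw [Ideal.mem_comap, h𝔪A, RingHom.mem_ker]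
    rw [hm, RingHom.mem_ker] at hb
    change evA (φ (Ideal.Quotient.mk Qσ g)) = 0
    change evp (Ideal.Quotient.mk Qσ g) = 0 at hb
    rw [hφmk]
    rw [Ideal.Quotient.liftₐ_apply, Ideal.Quotient.lift_mk] at hb ⊢
    rw [AlgHom.coe_toRingHom, hρ, aeval_rename]
    exact hb
  obtain ⟨P, hP, hP𝔪⟩ := Ideal.exists_minimalPrimes_le hmφ
  haveI hPp : P.IsPrime := hP.1.1
  -- the fibre inequality
  have hfib := Literature.RingTheory.KrullDimension.ringKrullDim_le_ringKrullDim_quotient_add F φ m P hP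
  haveI : IsDomain (A ⧸ P) := Ideal.Quotient.isDomain P
  obtain ⟨dP, hdP, -⟩ :=
    Literature.RingTheory.KrullDimension.exists_ringKrullDim_eq_and_trdeg_eq F (A ⧸ P)
  have hedP : e ≤ dP := by
    rw [hdimQ, hdP] at hfib
    have h1 : ((dZ : ℕ∞) : WithBot ℕ∞) ≤ ((dP : ℕ∞) : WithBot ℕ∞) + ((dY : ℕ∞) : WithBot ℕ∞) :=
      hfib.trans (add_le_add le_rfl hdimQσ)
    have h2 : dZ ≤ dP + dY := by exact_mod_cast h1
    omega
  -- the prime `P̃ ⊇ Q` of `F[σ ⊕ ι]` and the prime `Pι` of `F[ι]`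
  set Pt : Ideal (MvPolynomial (σ ⊕ ι) F) := P.comap (Ideal.Quotient.mk Q) with hPt
  have hQPt : Q ≤ Pt := fun f hf => by
    rw [hPt, Ideal.mem_comap, Ideal.Quotient.eq_zero_iff_mem.2 hf]
    exact P.zero_mem
  have hPt𝔪 : ∀ f ∈ Pt, aeval x₀ f = 0 := by
    intro f hf
    have h1 : Ideal.Quotient.mk Q f ∈ 𝔪A := hP𝔪 (Ideal.mem_comap.1 hf)
    rw [h𝔪A, RingHom.mem_ker] at h1
    change evA (Ideal.Quotient.mk Q f) = 0 at h1
    rwa [Ideal.Quotient.liftₐ_apply, Ideal.Quotient.lift_mk] at h1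
  have hXs : ∀ s, (X (Sum.inl s) - C (p s) : MvPolynomial (σ ⊕ ι) F) ∈ Pt := by
    intro s
    rw [hPt, Ideal.mem_comap]
    have h1 : Ideal.Quotient.mk Q (X (Sum.inl s) - C (p s)) =
        φ (Ideal.Quotient.mk Qσ (X s - C (p s))) := by
      rw [hφmk, hρ]
      congr 1
      rw [map_sub, rename_X, rename_C]
    rw [h1]
    refine hP.1.2 (Ideal.mem_map_of_mem _ ?_)
    rw [hm, RingHom.mem_ker]
    change evp (Ideal.Quotient.mk Qσ (X s - C (p s))) = 0
    rw [Ideal.Quotient.liftₐ_apply, Ideal.Quotient.lift_mk]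
    simp
  set ψ : MvPolynomial ι F →ₐ[F] MvPolynomial (σ ⊕ ι) F := rename Sum.inr with hψ
  set Pι : Ideal (MvPolynomial ι F) := Pt.comap ψ with hPι
  refine ⟨zeroLocus F Pι, ?_, isIrreducibleClosed_zeroLocus Pι, ?_, ?_⟩
  · -- `z ∈ X`
    rw [mem_zeroLocus_iff]
    intro g hg
    have := hPt𝔪 _ (Ideal.mem_comap.1 hg)
    rwa [hψ, hx₀, aeval_sumElim_rename_inr] at this
  · -- points of `X` give points of `Z_F(𝔯)` over `p`
    intro w hw
    rw [mem_zeroLocus_iff]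
    intro f hf
    have hf' : algebraMap (MvPolynomial (σ ⊕ ι) k) (MvPolynomial (σ ⊕ ι) F) f ∈ Pt :=
      hQPt (hQ.1.2 (Ideal.mem_map_of_mem _ hf))
    obtain ⟨g, hg⟩ := exists_rename_eq_substParams p
      (algebraMap (MvPolynomial (σ ⊕ ι) k) (MvPolynomial (σ ⊕ ι) F) f)
    have hgP : g ∈ Pι := by
      rw [hPι, Ideal.mem_comap, hψ, hg]
      have := sub_substParams_mem p Pt hXs
        (algebraMap (MvPolynomial (σ ⊕ ι) k) (MvPolynomial (σ ⊕ ι) F) f)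
      have h2 := Pt.sub_mem hf' this
      rwa [sub_sub_cancel] at h2
    have h3 : aeval w g = 0 := (mem_zeroLocus_iff.1 hw) g hgP
    rw [← aeval_sumElim_rename_inr p w g, hg, aeval_sumElim_substParams, halg,
      aeval_map_algebraMap] at h3
    exact h3
  · -- dimension
    rw [zariskiDim_zeroLocus_eq]
    -- `F[ι] ⧸ Pι ≃ F[σ ⊕ ι] ⧸ Pt ≃ A ⧸ P`
    set χ : MvPolynomial ι F →+* MvPolynomial (σ ⊕ ι) F ⧸ Pt :=
      (Ideal.Quotient.mk Pt).comp ψ.toRingHom with hχ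
    have hχsurj : Function.Surjective χ := by
      intro b
      obtain ⟨f, rfl⟩ := Ideal.Quotient.mk_surjective b
      obtain ⟨g, hg⟩ := exists_rename_eq_substParams p f
      refine ⟨g, ?_⟩
      change Ideal.Quotient.mk Pt (ψ g) = Ideal.Quotient.mk Pt f
      rw [hψ, hg, Ideal.Quotient.eq]
      have := sub_substParams_mem p Pt hXs f
      rwa [← neg_sub, neg_mem_iff] at this
    have hχker : RingHom.ker χ = Pι := by
      rw [hχ, ← RingHom.comap_ker, Ideal.mk_ker]
      rfl
    have e₁ : (MvPolynomial ι F ⧸ Pι) ≃+* (MvPolynomial (σ ⊕ ι) F ⧸ Pt) :=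
      (Ideal.quotEquivOfEq hχker.symm).trans (RingHom.quotientKerEquivOfSurjective hχsurj)
    have hmap : Pt.map (Ideal.Quotient.mk Q) = P :=
      Ideal.map_comap_of_surjective _ Ideal.Quotient.mk_surjective P
    have e₂ : (MvPolynomial (σ ⊕ ι) F ⧸ Pt) ≃+* (A ⧸ P) :=
      (DoubleQuot.quotQuotEquivQuotOfLE hQPt).symm.trans (Ideal.quotEquivOfEq hmap)
    have e₃ : (MvPolynomial ι F ⧸ Pι) ≃+* (A ⧸ P) := e₁.trans e₂
    have hdim3 : ringKrullDim (MvPolynomial ι F ⧸ Pι) = ringKrullDim (A ⧸ P) :=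
      le_antisymm (ringKrullDim_le_of_surjective e₃.symm.toRingHom e₃.symm.surjective)
        (ringKrullDim_le_of_surjective e₃.toRingHom e₃.surjective)
    rw [hdim3, hdP]
    exact_mod_cast hedP

end Fibre

end Literature.NumberTheory.Transcendental.Prop115
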